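import Summits.QuantumFields.YangMills.Theorems.BalabanUVNodesPortS1QtCQuad

/-!
# NODE O port PT-A — socket (o1) «D̃», leaf (o1-β)₃a: ◆ CRIT-1 g39's rider (R-k), FIRST BRIDGE — on the real slice DEF-1's complex linearisation IS the real one: `recordLQtC F k K Vk (x : ℝ-coords) = recordLQt F k K Vk x`
# (a THEOREM, no second derivative object), for every background in the (0.4) guard with loops within 1∕50 of 1; with the quantitative guard transport «‖x‖ < 1∕(10⁸dL) ⇒ pert Vk x is (0.4)-guarded»
# and the real-slice identity `recordQtC Vk ↑x = recordQt Vk x` on that ball ([I] p.267 «LQ̃ … L is a linear transformation», (2.4))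

Cell `ym-nodeO-ideate`, porter seat `ymgap-nodeO-port-PTA-1` (gen 9); `--kind proof --supports stmt-QuantumFields-27930 --as helper` (★★★ director-ym g23 №591 (1) GO; ★★ DEF-1 g39 15:26∕15:33Z; ◆ CRIT-1 g39 (R-k)).
Sequel of ✓`…PortS1QtCHol` (p827203) and ✓`…PortS1QtCQuad` (p827338).  [I] = [Balaban1987RG1].

CONTENT (theorems only; no `def`, no `instance`, no `sorry`): `norm_ofReal_pi_le` (`‖↑x‖ ≤ ‖x‖`), ★ `small_pert_of_norm_lt` (the REAL (0.4) guard at `pert Vk x` for `‖x‖ < 1∕(10⁸dL)`, from ✓`windows_of_norm_lt` + ✓`coe_loopHol`),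
★ `recordQtC_ofReal_of_norm_lt` (`recordQtC Vk ↑x = recordQt Vk x` on the ball), `differentiableAt_recordQtC_zero`, `hasFDerivAt_recordQt_zero` (the REAL `Q̃` is Fréchet-differentiable at `0` with derivative
`recordLQtC|_ℝ ∘ ↑`), ★★ `recordLQtC_ofReal` (THE BRIDGE).

HONEST FRAMING.  Chain rule + eventual equality over landed theorems; nothing of Bałaban's estimates asserted, ported or discharged; `D̃` not yet instantiated ((o1-δ)(o1-ε) wait on DEF-1's `…FluctHopC`);
`stub_P0C` ∕ `stub_FE` OPEN; ⟨27930⟩ ⁸-Ax-LR4 OPEN · no claim; NODE O 0∕1; COUNT 8∕28 · K 1∕4 UNMOVED; finite `𝕋⁴_{L^K}` at fixed ε — NOT continuum ∕ OS ∕ Clay; **the Yang–Mills mass gap is NOT proved by any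
of this.**  Standard axioms.
-/

noncomputable section

open scoped BigOperators Matrix.Norms.L2Operator Topology
open Set Metric Filter

namespace Summit.QuantumFields.YangMills.Theorems.BalabanUVNodesPortS1

open Literature.MathematicalPhysics.QuantumFieldTheory.Balaban1983to89
open Literature.MathematicalPhysics.QuantumFieldTheory.Balaban1983to89.Node00
open Literature.MathematicalPhysics.QuantumFieldTheory.Balaban1983to89.T4Continuum (T4Family)
open Literature.MathematicalPhysics.QuantumFieldTheory.Balaban1983to89.B15AveragingHolomorphic (avgMh loopMh loopMh_coeField)
open Summit.QuantumFields.YangMills.Theorems.K0RecordFormatNames (FluctIdx pert pertC pertC_ofReal recordQt recordQtC recordQtC_ofReal recordLQt recordLQtC)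
open BlockAveraging (Small Idx)
open ExpMeanLog (expMeanLogSU)

variable (F : T4Family)

/-- `‖(x_i : ℂ)_i‖ ≤ ‖x‖` (sup norms; in fact equality). [folklore] -/
theorem norm_ofReal_pi_le {ι : Type*} [Fintype ι] (x : ι → ℝ) : ‖(fun i => (x i : ℂ))‖ ≤ ‖x‖ :=
  (pi_norm_le_iff_of_nonneg (norm_nonneg x)).2 fun i => by rw [Complex.norm_real]; exact norm_le_pi_norm x i

/-- ★ **THE REAL (0.4) GUARD ON THE BALL**: for `‖x‖ < 1∕(10⁸·d·L)` the perturbed configuration `pert Vk x` is (0.4)-guarded at every coarse bond (its loop matrices are those of `pertC Vk ↑x`, within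
`7(φ+λ)+ε ≤ 1∕50 + 10⁻⁵ < 1∕3 = δ_{SU(2)}` of `1`). [cite: Balaban1987RG1, (0.4) p.253, (2.4) p.266] -/
theorem small_pert_of_norm_lt (k K : ℕ) (hk : k + 1 ≤ (F.P K).m + (F.P K).K) (Vk : GaugeField (F.P K) k (SU 2)) {ε : ℝ}
    (hε : ∀ (c : PBond (F.P K) (k + 1)) (i : Idx (F.P K)), ‖loopM (coeField Vk) c i - 1‖ ≤ ε) (hε50 : ε ≤ 1 / 50)
    (hVk : ∀ c, Small expMeanLogSU Vk c) (x : FluctIdx F k K → ℝ) (hx : ‖x‖ < 1 / (10 ^ 8 * (F.P K).d * (F.P K).L)) (c : PBond (F.P K) (k + 1)) :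
    Small expMeanLogSU (pert F k K Vk x) c := by
  intro i
  have hz : ‖(fun j => (x j : ℂ))‖ < 1 / (10 ^ 8 * (F.P K).d * (F.P K).L) := (norm_ofReal_pi_le x).trans_lt hx
  have hsum := phi_add_lam_le_of_norm_le (F.P K).hd (F.P K).hL.2.le (norm_nonneg (fun j => (x j : ℂ))) hz.le
  have hW := (windows_of_oneStep F k K hk Vk (fun j => (x j : ℂ)) (norm_pertC_mul_star_sub_one_le F k K Vk _) le_rfl le_rfl hε hsum hε50 c (hVk c)).1 i
  rw [pertC_ofReal, loopMh_coeField, ← coe_loopHol] at hW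
  have hε0 : 0 ≤ ε := (norm_nonneg _).trans (hε c i)
  have hgoal : ‖((BlockAveraging.loopHol (pert F k K Vk x) c i : SU 2) : MatA 2) - 1‖ < 1 / 3 := by linarith
  have h13 : (1 : ℝ) / 3 ≤ ExpMeanLog.deltaSU (Fin 2) := by
    unfold ExpMeanLog.deltaSU
    rw [Fintype.card_fin]
    exact le_min le_rfl (by push_cast; linarith [Real.pi_gt_three])
  exact lt_of_lt_of_le hgoal h13

/-- ★ **ON THE BALL THE COMPLEX CONSTRAINT IS THE REAL ONE**: `recordQtC Vk ↑x = recordQt Vk x` for `‖x‖ < 1∕(10⁸·d·L)` (✓`recordQtC_ofReal` at every coarse bond, the guard by `small_pert_of_norm_lt`).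
[cite: Balaban1987RG1, (2.4) p.266, p.267] -/
theorem recordQtC_ofReal_of_norm_lt (k K : ℕ) (hk : k + 1 ≤ (F.P K).m + (F.P K).K) (Vk : GaugeField (F.P K) k (SU 2)) {ε : ℝ}
    (hε : ∀ (c : PBond (F.P K) (k + 1)) (i : Idx (F.P K)), ‖loopM (coeField Vk) c i - 1‖ ≤ ε) (hε50 : ε ≤ 1 / 50)
    (hVk : ∀ c, Small expMeanLogSU Vk c) (x : FluctIdx F k K → ℝ) (hx : ‖x‖ < 1 / (10 ^ 8 * (F.P K).d * (F.P K).L)) :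
    recordQtC F k K Vk (fun i => (x i : ℂ)) = recordQt F k K Vk x :=
  funext fun c => recordQtC_ofReal F k K Vk x c (small_pert_of_norm_lt F k K hk Vk hε hε50 hVk x hx c)

/-- `Q̃_ℂ(Vk; ·)` is ℂ-differentiable at `0` (the centre of the ball). [cite: Balaban1987RG1, p.267] -/
theorem differentiableAt_recordQtC_zero (k K : ℕ) (hk : k + 1 ≤ (F.P K).m + (F.P K).K) (Vk : GaugeField (F.P K) k (SU 2)) {ε : ℝ}
    (hε : ∀ (c : PBond (F.P K) (k + 1)) (i : Idx (F.P K)), ‖loopM (coeField Vk) c i - 1‖ ≤ ε) (hε50 : ε ≤ 1 / 50)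
    (hVk : ∀ c, Small expMeanLogSU Vk c) :
    DifferentiableAt ℂ (recordQtC F k K Vk) 0 := by
  have hR : (0 : ℝ) < 1 / (10 ^ 8 * (F.P K).d * (F.P K).L) := by
    have hd : (1 : ℝ) ≤ (F.P K).d := by exact_mod_cast (F.P K).hd
    have hL : (1 : ℝ) ≤ (F.P K).L := by exact_mod_cast (F.P K).hL.2.le
    positivity
  exact (differentiableOn_recordQtC_ball F k K hk Vk hε hε50 hVk).differentiableAt (ball_mem_nhds _ hR)

/-- ★ **THE REAL `Q̃` IS FRÉCHET-DIFFERENTIABLE AT `0` WITH DERIVATIVE `recordLQtC|_ℝ ∘ (ℝ ↪ ℂ)`** (chain rule through the ℝ-linear embedding `x ↦ ↑x`, and the eventual equality `recordQt = recordQtC ∘ ↑`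
near `0`). [cite: Balaban1987RG1, p.267] -/
theorem hasFDerivAt_recordQt_zero (k K : ℕ) (hk : k + 1 ≤ (F.P K).m + (F.P K).K) (Vk : GaugeField (F.P K) k (SU 2)) {ε : ℝ}
    (hε : ∀ (c : PBond (F.P K) (k + 1)) (i : Idx (F.P K)), ‖loopM (coeField Vk) c i - 1‖ ≤ ε) (hε50 : ε ≤ 1 / 50)
    (hVk : ∀ c, Small expMeanLogSU Vk c) :
    HasFDerivAt (recordQt F k K Vk)
      (((recordLQtC F k K Vk).restrictScalars ℝ).comp
        (ContinuousLinearMap.pi fun i : FluctIdx F k K => Complex.ofRealCLM.comp (ContinuousLinearMap.proj i))) 0 := by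
  set ι : (FluctIdx F k K → ℝ) →L[ℝ] (FluctIdx F k K → ℂ) :=
    ContinuousLinearMap.pi fun i : FluctIdx F k K => Complex.ofRealCLM.comp (ContinuousLinearMap.proj i) with hιdef
  have hι : ∀ x : FluctIdx F k K → ℝ, ι x = fun i => (x i : ℂ) := fun x => rfl
  have hR : (0 : ℝ) < 1 / (10 ^ 8 * (F.P K).d * (F.P K).L) := by
    have hd : (1 : ℝ) ≤ (F.P K).d := by exact_mod_cast (F.P K).hd
    have hL : (1 : ℝ) ≤ (F.P K).L := by exact_mod_cast (F.P K).hL.2.le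
    positivity
  have hC : HasFDerivAt (recordQtC F k K Vk) (recordLQtC F k K Vk) (ι 0) := by
    rw [map_zero]
    exact (differentiableAt_recordQtC_zero F k K hk Vk hε hε50 hVk).hasFDerivAt
  have h1 : HasFDerivAt (fun x => recordQtC F k K Vk (ι x)) (((recordLQtC F k K Vk).restrictScalars ℝ).comp ι) 0 :=
    (hC.restrictScalars ℝ).comp 0 ι.hasFDerivAt
  refine h1.congr_of_eventuallyEq ?_
  filter_upwards [ball_mem_nhds (0 : FluctIdx F k K → ℝ) hR] with x hx
  rw [hι, recordQtC_ofReal_of_norm_lt F k K hk Vk hε hε50 hVk x (mem_ball_zero_iff.1 hx)]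

/-- ★★ **THE BRIDGE (◆ R-k): `recordLQtC F k K Vk ↑x = recordLQt F k K Vk x`** for every real coordinate vector `x` — DEF-1's complex `LQ̃_ℂ := fderiv ℂ (recordQtC Vk) 0` restricted to the real slice IS ed.15's real
`LQ̃ := fderiv ℝ (recordQt Vk) 0`; one object seen from two sides, no second derivative. [cite: Balaban1987RG1, p.267 («L is a linear transformation»)] -/
theorem recordLQtC_ofReal (k K : ℕ) (hk : k + 1 ≤ (F.P K).m + (F.P K).K) (Vk : GaugeField (F.P K) k (SU 2)) {ε : ℝ}
    (hε : ∀ (c : PBond (F.P K) (k + 1)) (i : Idx (F.P K)), ‖loopM (coeField Vk) c i - 1‖ ≤ ε) (hε50 : ε ≤ 1 / 50)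
    (hVk : ∀ c, Small expMeanLogSU Vk c) (x : FluctIdx F k K → ℝ) :
    recordLQtC F k K Vk (fun i => (x i : ℂ)) = recordLQt F k K Vk x := by
  have h := (hasFDerivAt_recordQt_zero F k K hk Vk hε hε50 hVk).fderiv
  have hdef : recordLQt F k K Vk = fderiv ℝ (recordQt F k K Vk) 0 := rfl
  rw [hdef, h]
  rfl

end Summit.QuantumFields.YangMills.Theorems.BalabanUVNodesPortS1

end
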